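import Literature.IUT.HodgeArakelov.ModelMonoThetaBaseDatumLim
import Literature.IUT.HodgeArakelov.ModelCyclotomesZHat

/-!
# [IUTchII] Cor. 1.10 at the GENUINE natural system, origin form: the binder `hZ` discharged

S. Mochizuki, *Inter-universal Teichmüller theory II*, §1, Cor. 1.10, kurims manuscript (Dec. 2020) p. 47
l. 15–27: "Then the data consisting of the topological group `Π`, the topological `Π`-modules constituted by the
domain and codomain of (∗mono-Θ_Π), and the isomorphism (∗mono-Θ_Π) determines a functor `ℛ → ℱ` [i.e., where `ℱ`
denotes the category defined in the evident way so as to accommodate the data just listed] which arises from a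
functorial algorithm in the topological group `Π`; denote the corresponding graph [cf. Example 1.9, (i)] by `ℛ†`.
In particular, the resulting natural functor `Ψ_ℛ : ℛ → ℛ†` [cf. Example 1.9, (i)] is multiradially defined."
[claim: Mochizuki2012, status: disputed] (IUTchII §1 Cor 1.10, kurims p.47); [EtTh] §1 p. 12 "`(Ẑ(1) ≅) Δ_Θ`"
[cite: MochizukiEtTh2009, §1 p.12].

abc-iut cell, layer L6; seat abc-iut-w5-d145 (gen 2; the W6-S1 / SUBDAG-IUTchII-Cor-110 lineage, rows S10a–S10d),
PROOF-ONLY companion (no definition, no new named fact) of abc-iut-w4-d038's closing files for rows C110-S8/S10 at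
the GENUINE natural projective system of model mono-theta environments of `X̲̲_K` (`ModelMonoThetaModulesLim`,
`ModelMonoThetaBaseDatumLim`: `EtaleLevels.familyLim_models`, `cor110_multiradiallyDefined_modelLim`). Those theorems
take the natural system's input `hZ : ∀ M, Nonempty ((l·Δ_Θ)(𝕄_M)/thetaKer ≃* Ẑ)` ("`(l·Δ_Θ)(M) ≅ Ẑ(1)`",
GAP-LEDGER G-w4d021-1) as a binder. Exactly as abc-iut-L2-t10 did for [IUTchII] Prop. 1.5 (`prop15_…_of_origin`,
`MonoThetaProjectiveThetaEnvFacts` / `…BridgeEtThFacts`), this file SUPPLIES `hZ` at every level by abc-iut-L2-d1's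
THEOREM `ModelCyclotomes.nonempty_lDeltaQuot_rigidData_mulEquiv_zHat` (⟸ the §1 origin hypotheses `IsEtThOrigin`
"`Δ_X` is a profinite free group on 2 generators", [EtTh] p. 12, and `hYcl` "`(Δ^tp_Y)^Θ` … profinite", p. 12 =
G-w4d021-2), so that the kernel residual of IUTchII:Cor1.10 at the genuine natural system is, BY NAME,
{[EtTh] Cor. 2.18 (i) at level `1` (`RigidData.Cor218_i`, FACT-policy), [EtTh] Prop. 1.5 (iii) (`Prop15iii`), the cusp
labels `CuspLabels`, `IsEtThOrigin`, `hYcl`} — the same list as the Prop. 1.5 model census, with no separate `hZ` row: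
* `EtaleLevels.cor110_multiradiallyDefined_modelLim_of_origin` — Cor. 1.10's printed conclusion at the genuine system;
* `EtaleLevels.familyLim_models_of_origin` — the junction C110-S10 (`Models`) at the genuine system, with the
  `Π^tp_{Ÿ}`-clause of the Prop. 1.4 output derived from Cor. 2.18 (i) (abc-iut-w4-d013) as in
  `familyLim_models_of_cor218_i`;
* `EtaleLevels.nonempty_monoThetaBaseDatum_of_origin` — non-vacuity of abc-iut-w5-d145's interface `MonoThetaBaseDatum`
  ([IUTchII] Cor. 1.10 base datum with its `Aut(Π₀)`-action) at the GENUINE natural system under the same inputs.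
HONEST FRAMING: conditional discharge modulo the inputs listed, which are NOT asserted; the [IUTchII] claim key
`Mochizuki2012` is DISPUTED (D-0012); no side is taken on [IUTchIII] Cor. 3.12; typed ≠ discharged.
-/

noncomputable section

namespace Literature.IUT.HodgeArakelov

open CategoryTheory Literature.AnabelianGeometry.EtaleTheta Literature.AnabelianGeometry.SemiGraphs
open scoped Literature.AnabelianGeometry.EtaleTheta

namespace EtaleLevels

variable {p : ℕ} [Fact p.Prime] {D : Literature.AnabelianGeometry.EtaleTheta.ThetaSetting p}
  {E : D.EtaleThetaData} {l : ℕ} (C : E.DoubleUnderline l) (hC : D.Compat) (hS : D.Sec2Hyps)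
  (hl : l.Prime) (hp2 : p ≠ 2) (hpl : p ≠ l) (hζ : ∃ ζ : D.K, IsPrimitiveRoot ζ (4 * l))
  (mods : ∀ M : ℕ+, D.CyclotomeMod l M)
  (f : contCocycles D.toTheta D.DeltaTheta C.GtpYdduu) (hf : f ∈ C.rootCocycles hC)
  (hmods : ∀ (M M' : ℕ+) (h : (M : ℕ) ∣ (M' : ℕ)) (x : D.lDeltaTheta l),
    MuN.red p M M' h ((mods M').red x) = (mods M).red x)
  (h15 : Literature.AnabelianGeometry.EtaleTheta.ThetaSetting.Prop15iii E hC) (L : C.CuspLabels)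
  (hO : D.IsEtThOrigin)
  (hYcl : (D.DtpY.map D.toHat.toMonoidHom).topologicalClosure ≤
    D.DtpY.map D.toHat.toMonoidHom ⊔ (⁅⁅D.DeltaHat, D.DeltaHat⁆, D.DeltaHat⁆).topologicalClosure)
  (h218i₁ : (levelRigid C hC hS mods h15 L 1).Cor218_i)

/-- **[IUTchII] Cor. 1.10 AT THE GENUINE NATURAL SYSTEM, origin form** (PROVED modulo [EtTh] Cor. 2.18 (i) at level `1`,
Prop. 1.5 (iii), the cusp labels and the §1 origin hypotheses `IsEtThOrigin`, `hYcl`): for the functor `ℛ → ℱ` of the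
functorial family `familyLim` over the natural system whose input "`(l·Δ_Θ)(M) ≅ Ẑ`" is abc-iut-L2-d1's theorem,
"the resulting natural functor `Ψ_ℛ : ℛ → ℛ†` is multiradially defined" (abc-iut-w4-d038's
`cor110_multiradiallyDefined_modelLim` with `hZ` supplied). [claim: Mochizuki2012, status: disputed] (IUTchII §1 Cor 1.10, kurims p.47) -/
theorem cor110_multiradiallyDefined_modelLim_of_origin (Γxμ : Type) [Group Γxμ] :
    ((ex18iii (setting C hC hS hl hp2 hpl hζ mods f hf) Γxμ).toDagger
      (CategoryTheory.Prod.fst _ _ ⋙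
        (familyLim C hC hS hl hp2 hpl hζ mods f hf hmods h15 L (fun M =>
            ModelCyclotomes.nonempty_lDeltaQuot_rigidData_mulEquiv_zHat C (mods M) hC hS h15 L hO hYcl hl.ne_zero)
          h218i₁).toRigidityFunctor.Ξ)).IsMultiradiallyDefined :=
  cor110_multiradiallyDefined_modelLim C hC hS hl hp2 hpl hζ mods f hf hmods h15 L _ h218i₁ Γxμ

/-- **IUTchII:Cor1.10, the junction C110-S10 AT THE GENUINE NATURAL SYSTEM, origin form**: the functorial family
`familyLim` MODELS (abc-iut-w5-d145's `MonoThetaRigidityData.Models`) the genuine output `((l·Δ_Θ)(𝕄_*), Π_μ(𝕄_*),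
(∗mono-Θ))` of [IUTchII] Props. 1.4 / 1.5 (iii) with its pinned module structures — abc-iut-w4-d038's
`familyLim_models_of_cor218_i` with the natural system's input `hZ` SUPPLIED by abc-iut-L2-d1's theorem. Residual
inputs BY NAME: `RigidData.Cor218_i` at level `1`, `Prop15iii`, `CuspLabels`, `IsEtThOrigin`, `hYcl` — the binder list
of the [IUTchII] Prop. 1.5 model census. [claim: Mochizuki2012, status: disputed] (IUTchII §1 Cor 1.10, kurims p.47) -/
theorem familyLim_models_of_origin :
    (familyLim C hC hS hl hp2 hpl hζ mods f hf hmods h15 L (fun M =>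
        ModelCyclotomes.nonempty_lDeltaQuot_rigidData_mulEquiv_zHat C (mods M) hC hS h15 L hO hYcl hl.ne_zero)
      h218i₁).Models
      (thetaEnvData C hC hS hl hp2 hpl hζ mods f hf hmods h15 L (fun M =>
        ModelCyclotomes.nonempty_lDeltaQuot_rigidData_mulEquiv_zHat C (mods M) hC hS h15 L hO hYcl hl.ne_zero)
        (EtaleThetaDataOfSetting.piYddCharacteristic_of_cor218_i C (mods 1) hC hS h15 L _ rfl h218i₁)
        (bijective_rigidLimHom C hC hS hl hp2 hpl hζ mods f hf hmods h15 L (fun M =>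
        ModelCyclotomes.nonempty_lDeltaQuot_rigidData_mulEquiv_zHat C (mods M) hC hS h15 L hO hYcl hl.ne_zero)))
      (moduleStrLim C hC hS hl hp2 hpl hζ mods f hf hmods h15 L (fun M =>
        ModelCyclotomes.nonempty_lDeltaQuot_rigidData_mulEquiv_zHat C (mods M) hC hS h15 L hO hYcl hl.ne_zero)
        (EtaleThetaDataOfSetting.piYddCharacteristic_of_cor218_i C (mods 1) hC hS h15 L _ rfl h218i₁)) :=
  familyLim_models_of_cor218_i C hC hS hl hp2 hpl hζ mods f hf hmods h15 L _ h218i₁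

include h218i₁ in
/-- **Non-vacuity of the [IUTchII] Cor. 1.10 base datum interface at the GENUINE natural system, origin form**:
abc-iut-w5-d145's `MonoThetaBaseDatum` (the two `Π₀`-modules, the equivariant (∗mono-Θ_{Π₀}) and the `Aut(Π₀)`-action
`ρ_A`, `ρ_B` with all transport laws) is INHABITED at `Π₀ = Π_X(𝕄_*) = Π^tp_{X̲̲}` by abc-iut-w4-d038's `baseDatumLim`,
under the inputs of `familyLim_models_of_origin` (Cor. 2.18 (i) at level `1`, Prop. 1.5 (iii), cusp labels,
`IsEtThOrigin`, `hYcl`). [claim: Mochizuki2012, status: disputed] (IUTchII §1 Cor 1.10, kurims p.47) -/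
theorem nonempty_monoThetaBaseDatum_of_origin :
    Nonempty (MonoThetaBaseDatum (setting C hC hS hl hp2 hpl hζ mods f hf)
      (basePointLim C hC hS hl hp2 hpl hζ mods f hf hmods h15 L (fun M =>
        ModelCyclotomes.nonempty_lDeltaQuot_rigidData_mulEquiv_zHat C (mods M) hC hS h15 L hO hYcl hl.ne_zero))) :=
  ⟨baseDatumLim C hC hS hl hp2 hpl hζ mods f hf hmods h15 L _ h218i₁⟩

end EtaleLevels

end Literature.IUT.HodgeArakelov

end
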